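import Summits.BirchSwinnertonDyer.BirchSwinnertonDyer.Theorems.ResidualThetaTransportAtTwoSignedMuVanishingAtTwoPlusCuspSpanGenerationTwoPrimes
import HarnessLib

/-!
# Node (G′)_N = `CuspSpanEvenAtTwo N` at the HABITAT⁺ CONDUCTORS of the form `p^a·q` (`a ≤ 2`): fifteen census levels, by the uniform
# theorem `TwoPrimes.cuspSpanEvenAtTwo_twoPrimes` — no certificate, no ERH, no kit

Cell `bsd-wall`, lead `bsd-wall-rtt-p4` g9 (crux Kμ⁺ stmt-BirchSwinnertonDyer-20689, line `birth`, stub `stub_flatMuZeroAtTwo` ⟸ node 27436).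
THEOREMS ONLY; helper `--supports` the crux; BSD is not proved by this. Of the 147 conductors of the 153 habitat⁺ census classes (route
`ResidualThetaTransportAtTwo`, `Cruxes/SignedMuVanishingAtTwoPlus/FlatCuspSpan.md`; kit j295333 verified (G′)_N by exact linear algebra at
76 of them and ran out of memory at 71), exactly 20 have two prime factors, and 15 of those are `p^a·q` with `a ≤ 2`:

| `N` | factorisation | | `N` | factorisation |
|---|---|---|---|---|
| 35131 | 43²·19 | | 283259 | 59·4801 |
| 96499 | 13²·571 | | 370999 | 37²·271 |
| 102187 | 17·6011 | | 403379 | 227·1777 |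
| 103691 | 7·14813 | | 417707 | 17·24571 |
| 115495 | 5·23099 | | 434429 | 43·10103 |
| 132845 | 163²·5 | | 448787 | 31²·467 |
| 160417 | 19·8443 | | 456777 | 3²·50753 |
| 173153 | 347·499 | | | |

(the prime conductor 270899 is rtt-p3-w2 g4's `cuspSpanEvenAtTwo_prime`; the other two-prime conductors 216243 = 3³·8009, 332019 = 3⁴·4099,
363609 = 3⁴·67², 435483 = 3³·127², 463347 = 3³·131² need the `B₂`-vanishing of `…CuspSpanGenerationRows`; 71 + 48 + 7 conductors have
3, 4, 5 prime factors). At each listed level the node holds in the kernel, hence FLAT (`2 ∤ L⁻` for every Pollack pair at `2`) for EVERY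
habitat⁺ class of that conductor by `TwoPrimes.flatAtTwo_of_conductor_twoPrimes` / `flatAtTwo_of_cuspSpanEvenAtTwo`, and the Kan⁺ / K1
per-class closers keyed to `CuspSpanEvenAtTwo N_W` apply by name. Nothing else is asserted.

References: R. Pollack, Duke Math. J. 118 (2003) Conj. 6.3 [Pollack2003]; R. S. Kulkarni, Amer. J. Math. 113 (1991) [Kulkarni1991].
-/

set_option autoImplicit false
set_option linter.dupNamespace false

namespace Summit.BirchSwinnertonDyer.BirchSwinnertonDyer.Theorems.SignedMuAtTwo

namespace TwoPrimes

/-- **`CuspSpanEvenAtTwo 35131`** — habitat⁺ conductor `35131 = 43²·19`, by `cuspSpanEvenAtTwo_twoPrimes`. [cite: Pollack2003, Conj. 6.3] -/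
theorem cuspSpanEvenAtTwo_35131 : CuspSpanEvenAtTwo 35131 :=
  cuspSpanEvenAtTwo_twoPrimes (p := 43) (q := 19) (a := 2) (by norm_num) (by norm_num) (by norm_num) (by norm_num)
    (by norm_num) (by norm_num) (by norm_num)

/-- **`CuspSpanEvenAtTwo 96499`** — habitat⁺ conductor `96499 = 13²·571`, by `cuspSpanEvenAtTwo_twoPrimes`. [cite: Pollack2003, Conj. 6.3] -/
theorem cuspSpanEvenAtTwo_96499 : CuspSpanEvenAtTwo 96499 :=
  cuspSpanEvenAtTwo_twoPrimes (p := 13) (q := 571) (a := 2) (by norm_num) (by norm_num) (by norm_num) (by norm_num)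
    (by norm_num) (by norm_num) (by norm_num)

/-- **`CuspSpanEvenAtTwo 102187`** — habitat⁺ conductor `102187 = 17·6011`, by `cuspSpanEvenAtTwo_twoPrimes`. [cite: Pollack2003, Conj. 6.3] -/
theorem cuspSpanEvenAtTwo_102187 : CuspSpanEvenAtTwo 102187 :=
  cuspSpanEvenAtTwo_twoPrimes (p := 17) (q := 6011) (a := 1) (by norm_num) (by norm_num) (by norm_num) (by norm_num)
    (by norm_num) (by norm_num) (by norm_num)

/-- **`CuspSpanEvenAtTwo 103691`** — habitat⁺ conductor `103691 = 7·14813`, by `cuspSpanEvenAtTwo_twoPrimes`. [cite: Pollack2003, Conj. 6.3] -/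
theorem cuspSpanEvenAtTwo_103691 : CuspSpanEvenAtTwo 103691 :=
  cuspSpanEvenAtTwo_twoPrimes (p := 7) (q := 14813) (a := 1) (by norm_num) (by norm_num) (by norm_num) (by norm_num)
    (by norm_num) (by norm_num) (by norm_num)

/-- **`CuspSpanEvenAtTwo 115495`** — habitat⁺ conductor `115495 = 5·23099`, by `cuspSpanEvenAtTwo_twoPrimes`. [cite: Pollack2003, Conj. 6.3] -/
theorem cuspSpanEvenAtTwo_115495 : CuspSpanEvenAtTwo 115495 :=
  cuspSpanEvenAtTwo_twoPrimes (p := 5) (q := 23099) (a := 1) (by norm_num) (by norm_num) (by norm_num) (by norm_num)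
    (by norm_num) (by norm_num) (by norm_num)

/-- **`CuspSpanEvenAtTwo 132845`** — habitat⁺ conductor `132845 = 163²·5`, by `cuspSpanEvenAtTwo_twoPrimes`. [cite: Pollack2003, Conj. 6.3] -/
theorem cuspSpanEvenAtTwo_132845 : CuspSpanEvenAtTwo 132845 :=
  cuspSpanEvenAtTwo_twoPrimes (p := 163) (q := 5) (a := 2) (by norm_num) (by norm_num) (by norm_num) (by norm_num)
    (by norm_num) (by norm_num) (by norm_num)

/-- **`CuspSpanEvenAtTwo 160417`** — habitat⁺ conductor `160417 = 19·8443`, by `cuspSpanEvenAtTwo_twoPrimes`. [cite: Pollack2003, Conj. 6.3] -/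
theorem cuspSpanEvenAtTwo_160417 : CuspSpanEvenAtTwo 160417 :=
  cuspSpanEvenAtTwo_twoPrimes (p := 19) (q := 8443) (a := 1) (by norm_num) (by norm_num) (by norm_num) (by norm_num)
    (by norm_num) (by norm_num) (by norm_num)

/-- **`CuspSpanEvenAtTwo 173153`** — habitat⁺ conductor `173153 = 347·499`, by `cuspSpanEvenAtTwo_twoPrimes`. [cite: Pollack2003, Conj. 6.3] -/
theorem cuspSpanEvenAtTwo_173153 : CuspSpanEvenAtTwo 173153 :=
  cuspSpanEvenAtTwo_twoPrimes (p := 347) (q := 499) (a := 1) (by norm_num) (by norm_num) (by norm_num) (by norm_num)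
    (by norm_num) (by norm_num) (by norm_num)

/-- **`CuspSpanEvenAtTwo 283259`** — habitat⁺ conductor `283259 = 59·4801`, by `cuspSpanEvenAtTwo_twoPrimes`. [cite: Pollack2003, Conj. 6.3] -/
theorem cuspSpanEvenAtTwo_283259 : CuspSpanEvenAtTwo 283259 :=
  cuspSpanEvenAtTwo_twoPrimes (p := 59) (q := 4801) (a := 1) (by norm_num) (by norm_num) (by norm_num) (by norm_num)
    (by norm_num) (by norm_num) (by norm_num)

/-- **`CuspSpanEvenAtTwo 370999`** — habitat⁺ conductor `370999 = 37²·271`, by `cuspSpanEvenAtTwo_twoPrimes`. [cite: Pollack2003, Conj. 6.3] -/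
theorem cuspSpanEvenAtTwo_370999 : CuspSpanEvenAtTwo 370999 :=
  cuspSpanEvenAtTwo_twoPrimes (p := 37) (q := 271) (a := 2) (by norm_num) (by norm_num) (by norm_num) (by norm_num)
    (by norm_num) (by norm_num) (by norm_num)

/-- **`CuspSpanEvenAtTwo 403379`** — habitat⁺ conductor `403379 = 227·1777`, by `cuspSpanEvenAtTwo_twoPrimes`. [cite: Pollack2003, Conj. 6.3] -/
theorem cuspSpanEvenAtTwo_403379 : CuspSpanEvenAtTwo 403379 :=
  cuspSpanEvenAtTwo_twoPrimes (p := 227) (q := 1777) (a := 1) (by norm_num) (by norm_num) (by norm_num) (by norm_num)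
    (by norm_num) (by norm_num) (by norm_num)

/-- **`CuspSpanEvenAtTwo 417707`** — habitat⁺ conductor `417707 = 17·24571`, by `cuspSpanEvenAtTwo_twoPrimes`. [cite: Pollack2003, Conj. 6.3] -/
theorem cuspSpanEvenAtTwo_417707 : CuspSpanEvenAtTwo 417707 :=
  cuspSpanEvenAtTwo_twoPrimes (p := 17) (q := 24571) (a := 1) (by norm_num) (by norm_num) (by norm_num) (by norm_num)
    (by norm_num) (by norm_num) (by norm_num)

/-- **`CuspSpanEvenAtTwo 434429`** — habitat⁺ conductor `434429 = 43·10103`, by `cuspSpanEvenAtTwo_twoPrimes`. [cite: Pollack2003, Conj. 6.3] -/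
theorem cuspSpanEvenAtTwo_434429 : CuspSpanEvenAtTwo 434429 :=
  cuspSpanEvenAtTwo_twoPrimes (p := 43) (q := 10103) (a := 1) (by norm_num) (by norm_num) (by norm_num) (by norm_num)
    (by norm_num) (by norm_num) (by norm_num)

/-- **`CuspSpanEvenAtTwo 448787`** — habitat⁺ conductor `448787 = 31²·467`, by `cuspSpanEvenAtTwo_twoPrimes`. [cite: Pollack2003, Conj. 6.3] -/
theorem cuspSpanEvenAtTwo_448787 : CuspSpanEvenAtTwo 448787 :=
  cuspSpanEvenAtTwo_twoPrimes (p := 31) (q := 467) (a := 2) (by norm_num) (by norm_num) (by norm_num) (by norm_num)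
    (by norm_num) (by norm_num) (by norm_num)

/-- **`CuspSpanEvenAtTwo 456777`** — habitat⁺ conductor `456777 = 3²·50753`, by `cuspSpanEvenAtTwo_twoPrimes`. [cite: Pollack2003, Conj. 6.3] -/
theorem cuspSpanEvenAtTwo_456777 : CuspSpanEvenAtTwo 456777 :=
  cuspSpanEvenAtTwo_twoPrimes (p := 3) (q := 50753) (a := 2) (by norm_num) (by norm_num) (by norm_num) (by norm_num)
    (by norm_num) (by norm_num) (by norm_num)

end TwoPrimes

end Summit.BirchSwinnertonDyer.BirchSwinnertonDyer.Theorems.SignedMuAtTwo
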